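import Summits.QuantumAdvantage.AdviceFreeQNC0.AffBells36PairSlice
import HarnessLib

/-!
# AffBells36 — pair slicing, stub S4 PROVED: few parts have fewer than `|P|/4` blind pairs
# (planner qa-qnc0-p1 g36, ROUND-35 §4.5–4.6, ask P-36d; skeleton `HOME/qa-qnc0-p1/exp36/PairSliceSkeleton36.lean`)

Prover qn-prover-3 g20.  The skeleton's vocabulary `PairSkel.{gamN, tiedAt, blindAt, firsts, freeSet}` is repeated VERBATIM and the
registered stub `PairSkel.S4` (verbatim) is proved: `s4_holds : S4`.

PROOF (no entropy bound, no explicit bijection).  For a pair-first `i` of the adjacent pairing `P` (so `γ_i, γ_{i+1} ≠ 0`) the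
pair is blind at the walk point `a` iff the TIE BIT `tiedAt a i = [u_{i−1} = u_{i+1}]` equals the target bit `[γ_i + γ_{i+1} = 0]`
(`blindAt_iff`).  MGF: `Σ_a λ^{#agreeing firsts} = 2ⁿ·((1+λ)/2)^{|P|}` EXACTLY (`sum_pow_agree`): peel the LARGEST first `i` —
flipping the coordinate `u_{i+1}` is an involution of the cube that flips the tie bit of `i` and no other (pair-firsts are
non-adjacent and `i` is maximal), so the sum factorises (`Finset.induction_on_max`).  Markov with `λ = 1/3`: parts with
`4·#blind < |P|` number `≤ 2ⁿ·(2/3)^{|P|}·3^{⌊|P|/4⌋} ≤ 2ⁿ·(16/27)^{⌊|P|/4⌋}`, and `|P| ≥ (n+1)/c₀`.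
WHAT THIS IS NOT: S3 (degree on a part) is not touched; `PairAlignedHard` still needs it.
-/

noncomputable section

open Classical

namespace Summit.QuantumAdvantage.AdviceFreeQNC0.AffBells36

open Finset

namespace PairSkel

variable {n : ℕ}

/-- `γ` extended to `ℕ` (0 out of range). (verbatim, PairSliceSkeleton36) -/
def gamN (γ : Fin (n + 1) → ZMod 3) (k : ℕ) : ZMod 3 := if h : k < n + 1 then γ ⟨k, h⟩ else 0

/-- the input pair `(x_j, x_{j+1})` of `xOfU a` is TIED iff `u_{j−1} = u_{j+1}` (`u_{−1} = false`, `u_n = true`). (verbatim) -/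
def tiedAt (a : Fin n → Bool) (j : ℕ) : Bool :=
  ((if j = 0 then false else uExt a (j - 1)) == uExt a (j + 1))

/-- the pair at `j` is BLIND for `γ` at the walk point `a` (reads `a_{j−1}, a_{j+1}` only). (verbatim) -/
def blindAt (γ : Fin (n + 1) → ZMod 3) (a : Fin n → Bool) (j : ℕ) : Prop :=
  (tiedAt a j = true ∧ gamN γ j + gamN γ (j + 1) = 0) ∨ (tiedAt a j = false ∧ gamN γ j = gamN γ (j + 1))

/-- pair-firsts as walk coordinates. (verbatim) -/
def firsts (P : Finset (Fin (n + 1))) : Finset (Fin n) := univ.filter fun i : Fin n => i.castSucc ∈ P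

/-- the FREE set of the part through `a`: its blind pair-firsts. (verbatim) -/
def freeSet (γ : Fin (n + 1) → ZMod 3) (P : Finset (Fin (n + 1))) (a : Fin n → Bool) : Finset (Fin n) :=
  univ.filter fun i : Fin n => i.castSucc ∈ P ∧ blindAt γ a i.val

/-- S4 (verbatim, the registered stub): few parts have fewer than `|P|/4` blind pairs. -/
def S4 : Prop := ∀ ε : ℝ, 0 < ε → ∀ c₀ : ℕ, ∃ n₀ : ℕ, ∀ n ≥ n₀, ∀ (γ : Fin (n + 1) → ZMod 3) (P : Finset (Fin (n + 1))),
  IsPairing P → n + 1 ≤ c₀ * P.card → (∀ j ∈ P, γ j ≠ 0) → (∀ j ∈ P, ∀ hj : j.val + 1 < n + 1, γ ⟨j.val + 1, hj⟩ ≠ 0) →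
    ((univ.filter fun a : Fin n → Bool => 4 * (freeSet γ P a).card < P.card).card : ℝ) ≤ ε * (2 : ℝ) ^ n

/-! ### Blindness is a tie-bit condition -/

/-- The target bit of position `j`: `[γ_j + γ_{j+1} = 0]`. -/
def tb (γ : Fin (n + 1) → ZMod 3) (j : ℕ) : Bool := decide (gamN γ j + gamN γ (j + 1) = 0)

/-- In `ℤ₃`, two non-zero elements are either equal or opposite, exclusively. -/
theorem add_eq_zero_iff_ne {a b : ZMod 3} (ha : a ≠ 0) (hb : b ≠ 0) : a + b = 0 ↔ ¬ a = b := by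
  revert a b; decide

/-- For a pair-first with non-zero coefficients, blindness is `tiedAt = tb`. -/
theorem blindAt_iff (γ : Fin (n + 1) → ZMod 3) (a : Fin n → Bool) (j : ℕ) (h0 : gamN γ j ≠ 0)
    (h1 : gamN γ (j + 1) ≠ 0) : blindAt γ a j ↔ tiedAt a j = tb γ j := by
  unfold blindAt tb
  have key := add_eq_zero_iff_ne h0 h1
  by_cases hs : gamN γ j + gamN γ (j + 1) = 0
  · rw [decide_eq_true hs]
    have hne : ¬ gamN γ j = gamN γ (j + 1) := key.mp hs
    constructor
    · rintro (⟨ht, -⟩ | ⟨-, he⟩)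
      · exact ht
      · exact absurd he hne
    · intro ht; exact Or.inl ⟨ht, hs⟩
  · rw [decide_eq_false hs]
    have he : gamN γ j = gamN γ (j + 1) := by
      by_contra h; exact hs (key.mpr h)
    constructor
    · rintro (⟨-, h⟩ | ⟨ht, -⟩)
      · exact absurd h hs
      · exact ht
    · intro ht; exact Or.inr ⟨ht, he⟩

/-! ### The tie bits of the pair-firsts are independent fair coins: an exact MGF -/

/-- Flipping the walk coordinate `k`. -/
def flipAt (k : Fin n) (a : Fin n → Bool) : Fin n → Bool := Function.update a k (!a k)

/-- `flipAt k` is an involution. -/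
theorem flipAt_flipAt (k : Fin n) (a : Fin n → Bool) : flipAt k (flipAt k a) = a := by
  funext i
  unfold flipAt
  by_cases h : i = k
  · subst h; simp
  · simp [Function.update_of_ne h]

/-- `uExt` off the flipped coordinate is unchanged. -/
theorem uExt_flipAt_of_ne (k : Fin n) (a : Fin n → Bool) {m : ℕ} (hm : m ≠ k.val) :
    uExt (flipAt k a) m = uExt a m := by
  unfold uExt flipAt
  by_cases h : m < n
  · rw [dif_pos h, dif_pos h, Function.update_of_ne]
    intro he; apply hm; rw [← he]
  · rw [dif_neg h, dif_neg h]

/-- `uExt` at the flipped coordinate is negated. -/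
theorem uExt_flipAt_self (k : Fin n) (a : Fin n → Bool) : uExt (flipAt k a) k.val = !uExt a k.val := by
  unfold uExt flipAt
  rw [dif_pos k.isLt, dif_pos k.isLt]
  simp

/-- Flipping `u_{i+1}` flips the tie bit of `i`. -/
theorem tiedAt_flip_self (a : Fin n → Bool) (i : Fin n) (hi : i.val + 1 < n) :
    tiedAt (flipAt ⟨i.val + 1, hi⟩ a) i.val = !tiedAt a i.val := by
  unfold tiedAt
  rw [uExt_flipAt_self ⟨i.val + 1, hi⟩ a]
  have hleft : (if i.val = 0 then false else uExt (flipAt ⟨i.val + 1, hi⟩ a) (i.val - 1)) =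
      (if i.val = 0 then false else uExt a (i.val - 1)) := by
    by_cases h0 : i.val = 0
    · rw [if_pos h0, if_pos h0]
    · rw [if_neg h0, if_neg h0, uExt_flipAt_of_ne ⟨i.val + 1, hi⟩ a (show i.val - 1 ≠ i.val + 1 by omega)]
  rw [hleft]
  cases (if i.val = 0 then false else uExt a (i.val - 1)) <;> cases uExt a (i.val + 1) <;> rfl

/-- Flipping `u_{i+1}` does not touch the tie bit of `x` when `x < i` and `x + 1 ≠ i + 1`, `x − 1 ≠ i + 1`. -/
theorem tiedAt_flip_of_lt (a : Fin n → Bool) (i x : Fin n) (hi : i.val + 1 < n) (hx : x < i) :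
    tiedAt (flipAt ⟨i.val + 1, hi⟩ a) x.val = tiedAt a x.val := by
  unfold tiedAt
  have hxi : x.val < i.val := hx
  rw [uExt_flipAt_of_ne ⟨i.val + 1, hi⟩ a (show x.val + 1 ≠ i.val + 1 by simp; omega)]
  by_cases h0 : x.val = 0
  · rw [if_pos h0, if_pos h0]
  · rw [if_neg h0, if_neg h0, uExt_flipAt_of_ne ⟨i.val + 1, hi⟩ a (show x.val - 1 ≠ i.val + 1 by simp; omega)]

/-- **Exact MGF of the agreement count**: for pair-firsts `F` (each `i + 1 < n`),
`Σ_a Π_{i ∈ F} (λ if tiedAt a i = t i else 1) = 2ⁿ·((1+λ)/2)^{|F|}`. -/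
theorem sum_prod_agree (lam : ℝ) (t : ℕ → Bool) (F : Finset (Fin n)) (hF : ∀ i ∈ F, i.val + 1 < n) :
    ∑ a : Fin n → Bool, ∏ i ∈ F, (if tiedAt a i.val = t i.val then lam else 1)
      = (2 : ℝ) ^ n * ((1 + lam) / 2) ^ F.card := by
  induction F using Finset.induction_on_max with
  | empty => simp [Fintype.card_bool, Fintype.card_fin]
  | insert i s hlt ih =>
    have his : i ∉ s := fun h => lt_irrefl _ (hlt i h)
    have hi : i.val + 1 < n := hF i (mem_insert_self i s)
    have hs : ∀ x ∈ s, x.val + 1 < n := fun x hx => hF x (mem_insert_of_mem hx)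
    rw [card_insert_of_notMem his, pow_succ]
    simp_rw [prod_insert his]
    set k : Fin n := ⟨i.val + 1, hi⟩ with hk
    -- the involution
    set φ : (Fin n → Bool) → (Fin n → Bool) := flipAt k with hφ
    have hφφ : Function.Involutive φ := fun a => flipAt_flipAt k a
    set f : (Fin n → Bool) → ℝ := fun a => ∏ x ∈ s, (if tiedAt a x.val = t x.val then lam else 1) with hf
    set g : (Fin n → Bool) → ℝ := fun a => (if tiedAt a i.val = t i.val then lam else 1) with hg
    have hfφ : ∀ a, f (φ a) = f a := by
      intro a
      simp only [hf, hφ]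
      refine prod_congr rfl fun x hx => ?_
      rw [tiedAt_flip_of_lt a i x hi (hlt x hx)]
    have hgφ : ∀ a, g a + g (φ a) = 1 + lam := by
      intro a
      simp only [hg, hφ]
      rw [tiedAt_flip_self a i hi]
      cases tiedAt a i.val <;> cases t i.val <;> simp <;> ring
    have hswap : ∑ a, g a * f a = ∑ a, g (φ a) * f a := by
      rw [← Equiv.sum_comp (hφφ.toPerm φ) (fun a => g a * f a)]
      refine sum_congr rfl fun a _ => ?_
      simp only [Function.Involutive.coe_toPerm]
      rw [hfφ]
    have h2 : 2 * ∑ a, g a * f a = (1 + lam) * ∑ a, f a := by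
      rw [two_mul]
      nth_rewrite 2 [hswap]
      rw [← sum_add_distrib, mul_sum]
      refine sum_congr rfl fun a _ => ?_
      rw [← add_mul, hgφ]
    have hIH : ∑ a, f a = (2 : ℝ) ^ n * ((1 + lam) / 2) ^ s.card := ih hs
    have : ∑ a, g a * f a = (2 : ℝ) ^ n * (((1 + lam) / 2) ^ s.card * ((1 + lam) / 2)) := by
      have := h2; rw [hIH] at this; linarith
    simpa [hg, hf] using this

/-! ### S4 -/

/-- The agreement count. -/
def agree (γ : Fin (n + 1) → ZMod 3) (P : Finset (Fin (n + 1))) (a : Fin n → Bool) : ℕ :=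
  ((firsts P).filter fun i => tiedAt a i.val = tb γ i.val).card

/-- For an adjacent pairing with non-zero coefficients, the free set is the set of agreeing firsts. -/
theorem freeSet_eq (γ : Fin (n + 1) → ZMod 3) (P : Finset (Fin (n + 1))) (hP : IsPairing P)
    (hγ0 : ∀ j ∈ P, γ j ≠ 0) (hγ1 : ∀ j ∈ P, ∀ hj : j.val + 1 < n + 1, γ ⟨j.val + 1, hj⟩ ≠ 0) (a : Fin n → Bool) :
    freeSet γ P a = (firsts P).filter fun i => tiedAt a i.val = tb γ i.val := by
  ext i
  unfold freeSet firsts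
  simp only [mem_filter, mem_univ, true_and]
  constructor
  · rintro ⟨hi, hb⟩
    have h2 : i.val + 2 < n + 1 := by simpa using (hP _ hi).1
    refine ⟨hi, (blindAt_iff γ a i.val ?_ ?_).mp hb⟩
    · unfold gamN; rw [dif_pos (by omega)]; exact hγ0 _ hi
    · unfold gamN; rw [dif_pos (by omega)]; exact hγ1 _ hi (by simp only [Fin.val_castSucc]; omega)
  · rintro ⟨hi, hb⟩
    have h2 : i.val + 2 < n + 1 := by simpa using (hP _ hi).1
    refine ⟨hi, (blindAt_iff γ a i.val ?_ ?_).mpr hb⟩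
    · unfold gamN; rw [dif_pos (by omega)]; exact hγ0 _ hi
    · unfold gamN; rw [dif_pos (by omega)]; exact hγ1 _ hi (by simp only [Fin.val_castSucc]; omega)

/-- `|firsts P| = |P|` for a pairing (every pair-first is `< n`). -/
theorem card_firsts (P : Finset (Fin (n + 1))) (hP : IsPairing P) : (firsts P).card = P.card := by
  have e : P = (firsts P).map Fin.castSuccEmb := by
    ext j
    simp only [firsts, mem_map, mem_filter, mem_univ, true_and, Fin.castSuccEmb_apply]
    constructor
    · intro hj
      have h2 := (hP j hj).1
      refine ⟨⟨j.val, by omega⟩, ?_, Fin.ext rfl⟩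
      have : (⟨j.val, by omega⟩ : Fin n).castSucc = j := Fin.ext rfl
      rw [this]; exact hj
    · rintro ⟨i, hi, rfl⟩; exact hi
  rw [e, card_map, ← e]

/-- **Markov bound**: `#{a : 4·agree < |P|}·(1/3)^{⌊|P|/4⌋} ≤ 2ⁿ·(2/3)^{|P|}`. -/
theorem card_bad_mul_le (γ : Fin (n + 1) → ZMod 3) (P : Finset (Fin (n + 1))) (hP : IsPairing P) :
    ((univ.filter fun a : Fin n → Bool => 4 * agree γ P a < P.card).card : ℝ) * (1 / 3 : ℝ) ^ (P.card / 4)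
      ≤ (2 : ℝ) ^ n * (2 / 3 : ℝ) ^ P.card := by
  have hF : ∀ i ∈ firsts P, i.val + 1 < n := by
    intro i hi
    unfold firsts at hi; rw [mem_filter] at hi
    have := (hP _ hi.2).1; simp at this; omega
  have hmgf := sum_prod_agree (1 / 3 : ℝ) (tb γ) (firsts P) hF
  rw [card_firsts P hP, show ((1 + (1 / 3 : ℝ)) / 2) = 2 / 3 from by norm_num] at hmgf
  rw [← hmgf]
  have hpt : ∀ a : Fin n → Bool, (∏ i ∈ firsts P, (if tiedAt a i.val = tb γ i.val then (1 / 3 : ℝ) else 1))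
      = (1 / 3 : ℝ) ^ agree γ P a := by
    intro a
    unfold agree
    rw [prod_ite, prod_const, prod_const_one, mul_one]
  simp_rw [hpt]
  rw [Finset.natCast_card_filter, sum_mul]
  refine sum_le_sum fun a _ => ?_
  by_cases hb : 4 * agree γ P a < P.card
  · rw [if_pos hb, one_mul]
    exact pow_le_pow_of_le_one (by norm_num) (by norm_num) (by omega)
  · rw [if_neg hb, zero_mul]; positivity

/-- **S4 PROVED.** -/
theorem s4_holds : S4 := by
  intro ε hε c₀
  obtain ⟨m₀, hm₀⟩ := exists_pow_lt_of_lt_one hε (by norm_num : (16 / 27 : ℝ) < 1)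
  refine ⟨4 * c₀ * (m₀ + 1), fun n hn γ P hP hPc hγ0 hγ1 => ?_⟩
  -- the bad set in terms of `agree`
  have hset : (univ.filter fun a : Fin n → Bool => 4 * (freeSet γ P a).card < P.card) =
      univ.filter fun a : Fin n → Bool => 4 * agree γ P a < P.card := by
    ext a; simp only [mem_filter, mem_univ, true_and, freeSet_eq γ P hP hγ0 hγ1 a]; rfl
  rw [hset]
  have hM := card_bad_mul_le γ P hP
  set m := P.card / 4 with hm
  set B : ℝ := ((univ.filter fun a : Fin n → Bool => 4 * agree γ P a < P.card).card : ℝ) with hB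
  have hB0 : 0 ≤ B := by positivity
  -- `m ≥ m₀`
  have hc₀ : 0 < c₀ := by
    rcases Nat.eq_zero_or_pos c₀ with h | h
    · subst h; simp at hPc
    · exact h
  have hmm₀ : m₀ ≤ m := by
    have h1 : c₀ * (4 * (m₀ + 1)) ≤ c₀ * P.card :=
      calc c₀ * (4 * (m₀ + 1)) = 4 * c₀ * (m₀ + 1) := by ring
        _ ≤ n := hn
        _ ≤ n + 1 := Nat.le_succ n
        _ ≤ c₀ * P.card := hPc
    have h2 : 4 * (m₀ + 1) ≤ P.card := Nat.le_of_mul_le_mul_left h1 hc₀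
    omega
  -- `(2/3)^P·3^m ≤ (16/27)^m`
  have hnum : (2 / 3 : ℝ) ^ P.card ≤ (16 / 27 : ℝ) ^ m * (1 / 3 : ℝ) ^ m := by
    have h4m : 4 * m ≤ P.card := Nat.mul_div_le P.card 4 |>.trans' (le_of_eq (by ring))
    calc (2 / 3 : ℝ) ^ P.card ≤ (2 / 3 : ℝ) ^ (4 * m) := pow_le_pow_of_le_one (by norm_num) (by norm_num) h4m
      _ = ((2 / 3 : ℝ) ^ 4) ^ m := by rw [pow_mul]
      _ = (16 / 27 : ℝ) ^ m * (1 / 3 : ℝ) ^ m := by rw [← mul_pow]; norm_num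
  have hpow : (16 / 27 : ℝ) ^ m ≤ (16 / 27 : ℝ) ^ m₀ := pow_le_pow_of_le_one (by norm_num) (by norm_num) hmm₀
  have h3 : (0 : ℝ) < (1 / 3 : ℝ) ^ m := by positivity
  -- divide the Markov bound by `(1/3)^m`
  have key : B ≤ (2 : ℝ) ^ n * (16 / 27 : ℝ) ^ m := by
    have : B * (1 / 3 : ℝ) ^ m ≤ (2 : ℝ) ^ n * ((16 / 27 : ℝ) ^ m * (1 / 3 : ℝ) ^ m) :=
      hM.trans (mul_le_mul_of_nonneg_left hnum (by positivity))
    rw [← mul_assoc] at this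
    exact le_of_mul_le_mul_right this h3
  have h2n : (0 : ℝ) ≤ (2 : ℝ) ^ n := by positivity
  calc B ≤ (2 : ℝ) ^ n * (16 / 27 : ℝ) ^ m := key
    _ ≤ (2 : ℝ) ^ n * (16 / 27 : ℝ) ^ m₀ := mul_le_mul_of_nonneg_left hpow h2n
    _ ≤ (2 : ℝ) ^ n * ε := mul_le_mul_of_nonneg_left hm₀.le h2n
    _ = ε * (2 : ℝ) ^ n := mul_comm _ _

end PairSkel

end Summit.QuantumAdvantage.AdviceFreeQNC0.AffBells36

end
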